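import Summits.ResolutionOfSingularities.ResolutionOfSingularities.Theorems.HilbertSamuelEliminationSigmaMaxModificationsCorridor3WLadderStrataCentrePointGerm
import Summits.ResolutionOfSingularities.ResolutionOfSingularities.Theorems.HilbertSamuelEliminationSigmaMaxModificationsCorridor3WLadderStrataCentreDispatchGeomDir
import Literature.AlgebraicGeometry.CossartJannsenSaito2020.ProjDirProjectiveLineRegular
import HarnessLib

/-!
# [OURS · L1 W4.2] The STRATA-half of the MOVING W-ladder, eleventh layer, β-twin: row (K-ctr-pt) FOR EVERY ORIGIN PREDICATE from the
# (F1♯) point-centre binder `Thm314_point_locus_geomDir` and `ProjDir_projLine`, and the REGIME-FREE strata row from print/binders +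
# (K-ctr-cv)⊤ + (c-geo)⊤ — PROVED

Crux chain w42 (`SigmaMaxModifications`, stmt-ResolutionOfSingularities-18506; conjunct stmt-ResolutionOfSingularities-19249), rows «stub-4 →
`Moving.Wlow3CharStrataM p` / β-twin `WlowStrataM p`» (the socket `hS` of stub-3's `wlow3TwoM_of_residue`), seat res-L1-w42-stub-4 (gen 4);
companion of p524566 (point germ, (F1) regime), p523382 (dispatch, every `Q`), res-D-pv-038's p520827. OURS (cell res-hironaka, slot W4.2);
NOT statements of H. Hironaka's manuscript [Hironaka2017] nor of [CossartJannsenSaito2020]; AI-drafted, weaker than expert review. Pure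
proofs (no definitions); binders BY NAME: `ProjDir_projLine` (printed, p516003) and the OURS (F1♯) binder `Thm314_point_locus_geomDir`
(stub-3 p507952: `Thm314_point_locus` with `CharHypothesis` ↦ `GeomDirHypothesis`, automatic at `ē ≤ 2`). Helper file
`--supports stmt-ResolutionOfSingularities-19249`.

* §1 res-D-pv-038's point-centre lemmas (p520827) re-run with the (F1♯) binder: `subset_projDirectrixFibre_of_subset_hsStratum_geomDir`,
  `componentsThrough_overCentre_eq_geomDir`, `strataCentreMembersClean_pointCase_geomDir`.
* §2 `StepProjection.pointGerm_members_clean_geomDir`, `strataPointCentreMembersClean_of_pointCase_geomDir : ProjDir_projLine →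
  Thm314_point_locus_geomDir → ∀ Q, StrataPointCentreMembersClean p 3 (QNe Q) (ē ≤ 2)` (the localisation of p524566 verbatim, with
  `GeomDirHypothesis` transported along `Spec 𝒪_{X_n,x_n} → X_n` by `geomDirDim_eq_of_isIso_stalkMap`).
* §3 **`wlowStrataM_of_geomDir_projLine_curve_centreIO : Theorem314_geomDir → Theorem314_nearFibre_geomDir → ProjDir_projLine →
  Thm314_point_locus_geomDir → (K-ctr-cv)⊤ → (c-geo)⊤ → WlowStrataM p`** and the `Q`-generic form.
* §4 `ProjDir_projLine` DISCHARGED by res-type-031's `ProjDir_projLine_holds` (p524078): **`wlow3CharStrataM_of_thm_3_14_pointLocus_curve_centreIO :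
  CossartJannsenSaito2020_thm_3_14 → Thm314_nearFibre_subsingleton → Thm314_point_locus → (K-ctr-cv) → (c-geo) → Wlow3CharStrataM p`** (three
  printed CJS facts + the two local kernels) and **`wlowStrataM_of_geomDir_pointLocus_curve_centreIO`** (three OURS (F1♯) binders + the two kernels at `⊤`).

References: CJS LNM 2270 Thm. 3.14, Def. 6.38 (ii), Prop. 6.31 [CossartJannsenSaito2020]; tree p520827, p507952, this seat's p523382 / p524566.
-/

noncomputable section

-- plan-1/idea-2 module setting kept (namespace `…Corridor3.Moving` re-enters `…Corridor3`)
set_option linter.dupNamespace false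

open CategoryTheory CategoryTheory.Limits AlgebraicGeometry TopologicalSpace Topology IsLocalRing
open Summit.ResolutionOfSingularities.ResolutionOfSingularities.Theorems.CampaignW42
open Literature.AlgebraicGeometry.Resolution Literature.RingTheory.HilbertSamuel
open Literature.AlgebraicGeometry.CossartJannsenSaito2020
open Summit.ResolutionOfSingularities.ResolutionOfSingularities.Theorems.SigmaMaxModificationsCorridor3

universe u

namespace Summit.ResolutionOfSingularities.ResolutionOfSingularities.Theorems.SigmaMaxModificationsCorridor3.Moving

variable {R : ∀ S : Scheme.{u}, CentreSeq S → Prop} {N : ℕ} {ν : ℕ → ℕ}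

/-! ## §1. res-D-pv-038's point-centre case with the (F1♯) binder -/

/-- 2.14♯ (point clause) over the stratum: a subset of the `ν`-stratum of `X′ = Bℓ_x(X)` lying over `x ∈ X(ν)` lies on `ℙ(Dir_x(X))`,
under `GeomDirHypothesis X x`. [cite: CossartJannsenSaito2020, Thm. 3.14] -/
theorem subset_projDirectrixFibre_of_subset_hsStratum_geomDir (h314 : Thm314_point_locus_geomDir.{u}) {X X' : Scheme.{u}}
    [IsLocallyNoetherian X] (π : X' ⟶ X) {x : X} (hx : IsClosed ({x} : Set X)) (hexc : Scheme.IsExcellent X)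
    (hperm : IdealSheafData.IsPermissible (Scheme.IdealSheafData.vanishingIdeal ⟨{x}, hx⟩))
    (hbl : IsBlowup π (Scheme.IdealSheafData.vanishingIdeal ⟨{x}, hx⟩))
    (hdim : topologicalKrullDim X ≤ (N : WithBot ℕ∞)) (hgdh : GeomDirHypothesis X x) (hν : Scheme.hsFun X N x = ν)
    {Z : Set X'} (hZW : Z ⊆ Scheme.hsStratum X' N ν) (hZx : π.base '' Z ⊆ {x}) :
    Z ⊆ projDirectrixFibre π x := by
  intro z hz
  have hπz : π.base z = x := hZx ⟨z, hz, rfl⟩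
  refine ⟨hπz, h314 X X' π x hx N z hexc hperm hbl hdim hπz hgdh ?_⟩
  rw [hν]
  exact hZW hz

/-- A member of `componentsThrough N ν s` over the blown-up point is `{x_{n+1}}` or `ℙ(Dir_x(X))` ((F1♯) form of p520827's lemma).
[cite: CossartJannsenSaito2020, Thm. 3.14, Def. 6.38 (ii)] -/
theorem componentsThrough_overCentre_eq_geomDir (hPa : ProjDir_projLine.{u}) (h314 : Thm314_point_locus_geomDir.{u})
    {X : Scheme.{u}} [IsLocallyNoetherian X] (s : MarkedStage.{u}) (π : s.W ⟶ X) {x : X}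
    (hx : IsClosed ({x} : Set X)) (hexc : Scheme.IsExcellent X)
    (hperm : IdealSheafData.IsPermissible (Scheme.IdealSheafData.vanishingIdeal ⟨{x}, hx⟩))
    (hbl : IsBlowup π (Scheme.IdealSheafData.vanishingIdeal ⟨{x}, hx⟩))
    (hdim : topologicalKrullDim X ≤ (N : WithBot ℕ∞)) (hgdh : GeomDirHypothesis X x) (hν : Scheme.hsFun X N x = ν)
    (he : Scheme.dirDim X x = 2) (hWc : IsClosed (Scheme.hsStratum s.W N ν))
    {Z : Set s.W} (hZ : Z ∈ componentsThrough N ν s) (hZx : π.base '' Z ⊆ {x}) :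
    Z = {s.pt} ∨ Z = projDirectrixFibre π x := by
  have hZc : IsClosed Z := componentsIn.isClosed hWc hZ.1
  exact eq_singleton_or_eq_projDir hPa π hx hbl he (componentsIn.isIrreducible hZ.1) hZc
    (subset_projDirectrixFibre_of_subset_hsStratum_geomDir h314 π hx hexc hperm hbl hdim hgdh hν (componentsIn.subset hZ.1) hZx)
    hZ.2

/-- **(K-ctr) at a point-centre step with `e = 2`, (F1♯) form** — both clauses (p520827's `strataCentreMembersClean_pointCase` with
`Thm314_point_locus` ↦ `Thm314_point_locus_geomDir`). [cite: CossartJannsenSaito2020, Thm. 3.14, Def. 6.38 (ii)] -/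
theorem strataCentreMembersClean_pointCase_geomDir (hPa : ProjDir_projLine.{u}) (h314 : Thm314_point_locus_geomDir.{u})
    {X : Scheme.{u}} [IsLocallyNoetherian X] (s : MarkedStage.{u}) (π : s.W ⟶ X) {x : X}
    (hx : IsClosed ({x} : Set X)) (hexc : Scheme.IsExcellent X)
    (hperm : IdealSheafData.IsPermissible (Scheme.IdealSheafData.vanishingIdeal ⟨{x}, hx⟩))
    (hbl : IsBlowup π (Scheme.IdealSheafData.vanishingIdeal ⟨{x}, hx⟩))
    (hdim : topologicalKrullDim X ≤ (N : WithBot ℕ∞)) (hgdh : GeomDirHypothesis X x) (hν : Scheme.hsFun X N x = ν)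
    (he : Scheme.dirDim X x = 2) (hWc : IsClosed (Scheme.hsStratum s.W N ν)) :
    (∀ Z ∈ componentsThrough N ν s, ∀ Z' ∈ componentsThrough N ν s,
        π.base '' Z ⊆ {x} → π.base '' Z' ⊆ {x} → Z = Z') ∧
      ∀ Z ∈ componentsThrough N ν s, π.base '' Z ⊆ {x} → IsRegularCurveAt s Z := by
  haveI : IsLocallyNoetherian s.W := s.ln
  have hmax : ∀ {A B : Set s.W}, A ∈ componentsThrough N ν s → B ∈ componentsThrough N ν s → A ⊆ B → A = B :=
    fun hA hB hAB => Set.Subset.antisymm hAB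
      ((mem_componentsIn_iff.1 hA.1).2.2 _ (componentsIn.subset hB.1) (componentsIn.isIrreducible hB.1) hAB)
  refine ⟨fun Z hZ Z' hZ' hZx hZ'x => ?_, fun Z hZ hZx => ?_⟩
  · rcases componentsThrough_overCentre_eq_geomDir hPa h314 s π hx hexc hperm hbl hdim hgdh hν he hWc hZ hZx with h1 | h1 <;>
      rcases componentsThrough_overCentre_eq_geomDir hPa h314 s π hx hexc hperm hbl hdim hgdh hν he hWc hZ' hZ'x with h2 | h2
    · rw [h1, h2]
    · exact hmax hZ hZ' (by rw [h1]; exact Set.singleton_subset_iff.2 hZ'.2)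
    · exact (hmax hZ' hZ (by rw [h2]; exact Set.singleton_subset_iff.2 hZ.2)).symm
    · rw [h1, h2]
  · rcases componentsThrough_overCentre_eq_geomDir hPa h314 s π hx hexc hperm hbl hdim hgdh hν he hWc hZ hZx with rfl | rfl
    · refine ⟨Set.mem_singleton _, fun hZc => ?_, fun A _ _ hptA hAZ => Or.inl ?_⟩
      · rw [stalkIdeal_vanishingIdeal_singleton hZc]
        haveI : (maximalIdeal (s.W.presheaf.stalk s.pt)).IsMaximal := maximalIdeal.isMaximal _
        letI : Field (s.W.presheaf.stalk s.pt ⧸ maximalIdeal (s.W.presheaf.stalk s.pt)) := Ideal.Quotient.field _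
        infer_instance
      · exact Set.Subset.antisymm hAZ (Set.singleton_subset_iff.2 hptA)
    · obtain ⟨hPc, -, -, -, hreg⟩ := hPa X s.W π x hx hbl he
      refine ⟨hZ.2, fun hZc => (hreg hZc s.pt hZ.2).1, fun A hA hAc hptA hAZ => ?_⟩
      exact eq_singleton_or_eq_projDir hPa π hx hbl he hA hAc hAZ hptA

/-! ## §2. Row (K-ctr-pt) for every origin predicate by localisation -/

/-- **(K-ctr-pt) ALONG ONE STEP PROJECTION, (F1♯) form** (modulo `ProjDir_projLine`, `Thm314_point_locus_geomDir`): for the blow-down `f : X_{n+1} ⟶ X_n`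
of a canonical near step with regular permissible centre `C ∋ x_n` having point germ at `x_n`, on an excellent Noetherian stage of
dimension `≤ N` with (F1) at `x_n ∈ X_n(ν)` and `e_{x_n} = 2`, the components of `X_{n+1}(ν)` through `x_{n+1}` over `x_n` number at
most one and are regular curves at `x_{n+1}` — by localising at `x_n` (module docstring).
[cite: CossartJannsenSaito2020, Thm. 3.14, Def. 6.38 (ii), Prop. 6.31, p. 107] -/
theorem StepProjection.pointGerm_members_clean_geomDir (hPa : ProjDir_projLine.{u}) (h314pt : Thm314_point_locus_geomDir.{u})
    (hRf : OracleFunctional R) {s s' : MarkedStage.{u}} {f : s'.W ⟶ s.W} (hf : StepProjection R N ν s s' f)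
    {C : s.W.IdealSheafData} {P' : Option (Pending (blowup C))} (hcs : IsCanonicalStep R N ν s.L s.P C P')
    [IsNoetherian s.W] (hs'N : IsNoetherian s'.W) (hexcW : Scheme.IsExcellent s.W)
    (hdimW : topologicalKrullDim s.W ≤ (N : WithBot ℕ∞)) (hgdh : @GeomDirHypothesis s.W s.ln s.pt)
    (hptn : s.pt ∈ Scheme.hsStratum s.W N ν) (hY'cl : IsClosed (Scheme.hsStratum s'.W N ν))
    (hCreg : Scheme.IsRegular C.subscheme) (hCperm : IdealSheafData.IsPermissible C) (hxC : s.pt ∈ (C.support : Set s.W))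
    (hgerm : ∀ a ∈ (C.support : Set s.W), a ⤳ s.pt → a = s.pt) (he : dirDim s = 2) :
    (∀ Z' ∈ componentsThrough N ν s', ∀ Z'' ∈ componentsThrough N ν s',
        f.base '' Z' ⊆ {s.pt} → f.base '' Z'' ⊆ {s.pt} → Z' = Z'') ∧
      ∀ Z' ∈ componentsThrough N ν s', f.base '' Z' ⊆ {s.pt} → IsRegularCurveAt s' Z' := by
  haveI := s.ln
  -- pass to the chosen blow-up
  obtain ⟨C₂, P₂, hln, x', hcs₂, hπ, hcl, hx', e, rfl⟩ := hf
  obtain rfl : C₂ = C := hcs₂.centre_unique hRf hcs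
  subst e
  simp only [eqToHom_refl, Category.id_comp]
  haveI : IsLocallyNoetherian (blowup C₂) := hln
  haveI : IsNoetherian (blowup C₂) := hs'N
  have hY'cl' : IsClosed (Scheme.hsStratum (blowup C₂) N ν) := hY'cl
  -- the localisation `ι₀ : Spec 𝒪_{W,x_n} → W` and the base-changed step
  haveI : IsProper (blowup.π C₂) := (blowup.isBlowup C₂).isProper
  set ι₀ := s.W.fromSpecStalk s.pt with hι₀
  haveI : Flat ι₀ := flat_fromSpecStalk s.W s.pt
  set P := pullback (blowup.π C₂) ι₀ with hP
  set j : P ⟶ blowup C₂ := pullback.fst (blowup.π C₂) ι₀ with hj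
  set πP : P ⟶ Spec (s.W.presheaf.stalk s.pt) := pullback.snd (blowup.π C₂) ι₀ with hπP
  have hsq : j ≫ blowup.π C₂ = πP ≫ ι₀ := pullback.condition
  haveI : IsLocallyNoetherian P := LocallyOfFiniteType.isLocallyNoetherian πP
  -- the centre pulls back to the closed point
  set o := closedPoint (s.W.presheaf.stalk s.pt) with ho
  have hoc : IsClosed ({o} : Set ↥(Spec (s.W.presheaf.stalk s.pt))) := isClosed_singleton_closedPoint _
  let Co : Closeds ↥(Spec (s.W.presheaf.stalk s.pt)) := ⟨{o}, hoc⟩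
  have hι₀o : ι₀.base o = s.pt := Scheme.fromSpecStalk_closedPoint
  haveI := hCreg.isReduced
  have hCv : C₂ = Scheme.IdealSheafData.vanishingIdeal C₂.support := by
    have h1 : C₂ = (⊥ : C₂.subscheme.IdealSheafData).map C₂.subschemeι := by
      rw [Scheme.IdealSheafData.map_bot, Scheme.IdealSheafData.ker_subschemeι]
    have h2 : (⊥ : C₂.subscheme.IdealSheafData) = Scheme.IdealSheafData.vanishingIdeal ⊤ := by
      rw [Scheme.IdealSheafData.vanishingIdeal_top, Scheme.nilradical_eq_bot]
    rw [h1, h2, Scheme.IdealSheafData.map_vanishingIdeal]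
    congr 1
  have hpre : C₂.support.preimage ι₀.continuous = Co := by
    apply Closeds.ext
    ext q
    change ι₀.base q ∈ (C₂.support : Set s.W) ↔ q ∈ ({o} : Set _)
    constructor
    · intro hq'
      have hqx : ι₀.base q = s.pt := hgerm _ hq' (fromSpecStalk_specializes q)
      exact ι₀.isEmbedding.injective (hqx.trans hι₀o.symm)
    · rintro rfl
      rw [hι₀o]; exact hxC
  have hcomapC : C₂.comap ι₀ = Scheme.IdealSheafData.vanishingIdeal Co := by
    conv_lhs => rw [hCv]
    rw [comap_vanishingIdeal_eq_of_flat_of_isPreimmersion ι₀ C₂.support, hpre]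
  have hbl : IsBlowup πP (Scheme.IdealSheafData.vanishingIdeal Co) :=
    hcomapC ▸ (blowup.isBlowup C₂).pullback_snd_of_flat ι₀
  -- the marked point of `P` over `x'` and `o`
  have hx'o : (blowup.π C₂).base x' = ι₀.base o := by rw [hπ, hι₀o]
  obtain ⟨q, hjq, hπPq⟩ := Scheme.Pullback.exists_preimage_pullback (f := blowup.π C₂) (g := ι₀) x' o hx'o
  let sP : MarkedStage.{u} := ⟨P, inferInstance, Labelling.init P, none, q⟩
  -- hypotheses of the point-centre theorem on `Spec 𝒪_{W,x_n}`
  haveI := isIso_stalkMap_of_flat_of_isPreimmersion ι₀ o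
  have hexc : Scheme.IsExcellent (Spec (s.W.presheaf.stalk s.pt)) :=
    Scheme.isExcellent_Spec_of_isExcellentRing _ (isExcellentRing_stalk_of_isExcellent hexcW s.pt)
  have hperm : IdealSheafData.IsPermissible (Scheme.IdealSheafData.vanishingIdeal Co) :=
    hcomapC ▸ isPermissible_comap_of_flat_of_isPreimmersion ι₀ C₂ hCperm
  have hdim : topologicalKrullDim ↥(Spec (s.W.presheaf.stalk s.pt)) ≤ (N : WithBot ℕ∞) :=
    ι₀.isEmbedding.isInducing.topologicalKrullDim_le.trans hdimW
  have hgdhP : GeomDirHypothesis (Spec (s.W.presheaf.stalk s.pt)) o := by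
    have hκ : ringChar (ResidueField ((Spec (s.W.presheaf.stalk s.pt)).presheaf.stalk o)) =
        ringChar (ResidueField (s.W.presheaf.stalk s.pt)) := by
      rw [Helpers.ringChar_residueField_eq_of_hom' ι₀ o, hι₀o]
    have hgd : Scheme.geomDirDim (Spec (s.W.presheaf.stalk s.pt)) o = Scheme.geomDirDim s.W s.pt := by
      rw [Scheme.geomDirDim_eq_of_isIso_stalkMap ι₀ o, hι₀o]
    unfold GeomDirHypothesis at hgdh ⊢
    rw [hκ, hgd]
    exact hgdh
  have hνP : Scheme.hsFun (Spec (s.W.presheaf.stalk s.pt)) N o = ν := by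
    rw [Scheme.hsFun_eq_of_isIso_stalkMap ι₀ N o, hι₀o]
    exact Scheme.mem_hsStratum_iff.mp hptn
  have heP : Scheme.dirDim (Spec (s.W.presheaf.stalk s.pt)) o = 2 := by
    rw [Scheme.dirDim_eq_of_isIso_stalkMap ι₀ o, hι₀o]
    exact he
  -- the stratum of `P` is the preimage of the stratum of `Bl`, hence closed
  have hstrP : Scheme.hsStratum P N ν = j.base ⁻¹' Scheme.hsStratum (blowup C₂) N ν := by
    ext z
    haveI := isIso_stalkMap_of_flat_of_isPreimmersion j z
    rw [Scheme.mem_hsStratum_iff, Set.mem_preimage, Scheme.mem_hsStratum_iff, Scheme.hsFun_eq_of_isIso_stalkMap j N z]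
  have hWc : IsClosed (Scheme.hsStratum sP.W N ν) := by
    change IsClosed (Scheme.hsStratum P N ν)
    rw [hstrP]; exact hY'cl'.preimage j.continuous
  -- res-D-pv-038's theorem on the localised step
  obtain ⟨huniq, hregP⟩ := strataCentreMembersClean_pointCase_geomDir (N := N) (ν := ν) hPa h314pt sP πP hoc hexc hperm hbl hdim
    hgdhP hνP heP hWc
  -- members over `x_n` correspond to members of `P` through `q` over `o`
  have hrange : (blowup.π C₂).base ⁻¹' {s.pt} ⊆ Set.range j.base := by
    intro z hz
    rw [hj, Scheme.Pullback.range_fst]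
    exact ⟨o, hι₀o.trans (Set.mem_singleton_iff.mp hz).symm⟩
  have hmem : ∀ Z' ∈ componentsThrough N ν
      (⟨blowup C₂, hln, s.L.next (Scheme.hsStratum s.W N ν) C₂, P₂, x'⟩ : MarkedStage.{u}),
      (blowup.π C₂).base '' Z' ⊆ {s.pt} →
      j.base ⁻¹' Z' ∈ componentsThrough N ν sP ∧ πP.base '' (j.base ⁻¹' Z') ⊆ {o} ∧ Z' ⊆ Set.range j.base := by
    intro Z' hZ' hZ'x
    have hZ'r : Z' ⊆ Set.range j.base := fun z hz => hrange (hZ'x ⟨z, hz, rfl⟩)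
    have hZ'irr : IsIrreducible Z' := componentsIn.isIrreducible hZ'.1
    refine ⟨⟨?_, ?_⟩, ?_, hZ'r⟩
    · -- a component of the stratum of `P`
      refine mem_componentsIn_iff.mpr ⟨?_, isIrreducible_preimage_of_isEmbedding j.isEmbedding hZ'irr hZ'r, ?_⟩
      · change j.base ⁻¹' Z' ⊆ Scheme.hsStratum P N ν
        rw [hstrP]; exact Set.preimage_mono (componentsIn.subset hZ'.1)
      · intro T hT hTirr hsub
        -- `closure j(T)` is irreducible, inside the (closed) stratum, and contains `Z′`
        have h1 : Z' ⊆ closure (j.base '' T) := by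
          intro z hz
          obtain ⟨t, rfl⟩ := hZ'r hz
          exact subset_closure ⟨t, hsub hz, rfl⟩
        have h2 : closure (j.base '' T) ⊆ Scheme.hsStratum (blowup C₂) N ν := by
          refine closure_minimal ?_ hY'cl'
          rintro _ ⟨t, ht, rfl⟩
          have := hT ht
          change t ∈ Scheme.hsStratum P N ν at this
          rw [hstrP] at this
          exact this
        have h3 : closure (j.base '' T) = Z' :=
          ((mem_componentsIn_iff.mp hZ'.1).2.2 _ h2 ((hTirr.image _ j.continuous.continuousOn).closure) h1).antisymm h1
        intro t ht
        show j.base t ∈ Z'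
        rw [← h3]; exact subset_closure ⟨t, ht, rfl⟩
    · show q ∈ j.base ⁻¹' Z'
      rw [Set.mem_preimage, hjq]; exact hZ'.2
    · rintro _ ⟨t, ht, rfl⟩
      have h1 : ι₀.base (πP.base t) = s.pt := by
        have := congrArg (fun φ => φ.base t) hsq
        change ((j ≫ blowup.π C₂).base t) = ((πP ≫ ι₀).base t) at this
        rw [Scheme.Hom.comp_apply, Scheme.Hom.comp_apply] at this
        rw [← this]; exact hZ'x ⟨_, ht, rfl⟩
      exact ι₀.isEmbedding.injective (h1.trans hι₀o.symm)
  refine ⟨fun Z' hZ' Z'' hZ'' h' h'' => ?_, fun Z' hZ' h' => ?_⟩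
  · obtain ⟨hm', ho', hr'⟩ := hmem Z' hZ' h'
    obtain ⟨hm'', ho'', hr''⟩ := hmem Z'' hZ'' h''
    have heq := huniq _ hm' _ hm'' ho' ho''
    rw [← Set.image_preimage_eq_of_subset hr', ← Set.image_preimage_eq_of_subset hr'']
    exact congrArg _ heq
  · obtain ⟨hm', ho', -⟩ := hmem Z' hZ' h'
    have hregZ := hregP _ hm' ho'
    exact isRegularCurveAt_of_preimage (s := ⟨blowup C₂, hln, s.L.next (Scheme.hsStratum s.W N ν) C₂, P₂, x'⟩)
      (s' := sP) j hjq hcl (componentsIn.isIrreducible hZ'.1) (componentsIn.isClosed hY'cl' hZ'.1) hregZ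


/-- **ROW (K-ctr-pt) FOR EVERY ORIGIN PREDICATE** (modulo `ProjDir_projLine` and the (F1♯) binder `Thm314_point_locus_geomDir`, whose
hypothesis is automatic at `ē ≤ 2`). [cite: CossartJannsenSaito2020, Thm. 3.14, Def. 6.38 (ii), Prop. 6.31] -/
theorem strataPointCentreMembersClean_of_pointCase_geomDir {p : ℕ} (hPa : ProjDir_projLine.{u})
    (h314pt : Thm314_point_locus_geomDir.{u}) (Q : ℕ → (ℕ → ℕ) → ∀ X : Scheme.{u}, X → Prop) :
    StrataPointCentreMembersClean.{u} p 3 (QNe Q) fun s => s.geomDirDim ≤ 2 := by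
  intro R hRf hRa ν X _ x hX hQ c h0 hstep hG _ _
  obtain ⟨-, hν⟩ := hQ
  obtain ⟨k, _, _, g, -, hft, hqc⟩ := hX.exists_structure
  haveI := hft
  haveI := hqc
  haveI := hX.isReduced
  obtain ⟨-, k', _, hinv⟩ := exists_cycleInv_chain' hRf hRa hX h0 hstep
  refine ⟨0, fun n _ C P' hcs hxC hgerm he f hf => ?_⟩
  have hgood : StateGood k R 3 ν (c n).W (c n).L (c n).P :=
    stateGood_of_reaches (stateGood_init_general hRa g hX.dim_le hX.maximal hν) (reaches_chain h0 hstep n)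
  have hgdh : @GeomDirHypothesis (c n).W (c n).ln (c n).pt :=
    @geomDirHypothesis_of_geomDirDim_le_two (c n).W (c n).ln (c n).pt (hG n)
  have hptn : (c n).pt ∈ Scheme.hsStratum (c n).W 3 ν := pt_mem_hsStratum_of_reaches hX.mem_stratum (reaches_chain h0 hstep n)
  obtain ⟨hCreg, -, hCperm, -⟩ := (hinv n).centre hRa hν hcs
  haveI : IsLocallyNoetherian (c n).W := (c n).ln
  haveI : IsNoetherian (c n).W := (hinv n).isNoetherian
  exact hf.pointGerm_members_clean_geomDir hPa h314pt hRf hcs (hinv (n + 1)).isNoetherian hgood.isExcellent hgood.dim_le hgdh hptn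
    (hinv (n + 1)).isClosed_hsStratum hCreg hCperm hxC hgerm he

/-! ## §3. The regime-free strata row from binders/print and the two local kernels -/

/-- **The strata row at any `Q` FROM `Theorem314_geomDir`, `Theorem314_nearFibre_geomDir`, `ProjDir_projLine`, `Thm314_point_locus_geomDir`,
(K-ctr-cv) and (c-geo).** [cite: CossartJannsenSaito2020, Thm. 3.14, Def. 6.38 (ii), Rem. 6.29 (1)] -/
theorem maxOriginNoMovingNearChainAtQ_notIso_of_geomDir_projLine_curve_centreIO {p : ℕ}
    {Q : ℕ → (ℕ → ℕ) → ∀ X : Scheme.{u}, X → Prop} (hF : Theorem314_geomDir.{u}) (hFf : Theorem314_nearFibre_geomDir.{u})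
    (hPa : ProjDir_projLine.{u}) (h314pt : Thm314_point_locus_geomDir.{u})
    (hcv : StrataCurveCentreDominantClean.{u} p 3 (QNe Q) fun s => s.geomDirDim ≤ 2)
    (hgeo : StrataLineageInCentreIO p 3 (QNe Q) fun s => s.geomDirDim ≤ 2) :
    MaxOriginNoMovingNearChainAtQ p 3 Q fun s => s.geomDirDim ≤ 2 ∧ ¬ Iso 3 s :=
  maxOriginNoMovingNearChainAtQ_notIso_of_geomDir_point_curve_centreIO hF hFf
    (strataPointCentreMembersClean_of_pointCase_geomDir hPa h314pt Q) hcv hgeo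

/-- **`WlowStrataM p` (stub-3's socket `hS`) FROM the four binders/printed facts and the two local kernels (K-ctr-cv)⊤, (c-geo)⊤.**
[cite: CossartJannsenSaito2020, Thm. 3.14, Def. 6.38 (ii), Thm. 6.35, Rem. 6.29 (1)] -/
theorem wlowStrataM_of_geomDir_projLine_curve_centreIO {p : ℕ} (hF : Theorem314_geomDir.{0})
    (hFf : Theorem314_nearFibre_geomDir.{0}) (hPa : ProjDir_projLine.{0}) (h314pt : Thm314_point_locus_geomDir.{0})
    (hcv : StrataCurveCentreDominantClean.{0} p 3 (QNe fun _ _ _ _ => True) fun s => s.geomDirDim ≤ 2)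
    (hgeo : StrataLineageInCentreIO.{0} p 3 (QNe fun _ _ _ _ => True) fun s => s.geomDirDim ≤ 2) : WlowStrataM p :=
  maxOriginNoMovingNearChainAt_of_atQ_true
    (maxOriginNoMovingNearChainAtQ_notIso_of_geomDir_projLine_curve_centreIO hF hFf hPa h314pt hcv hgeo)

/-! ## §4. `ProjDir_projLine` discharged (res-type-031, p524078) -/

/-- **NET OF RECORD, (F1) regime: `Wlow3CharStrataM p` FROM THREE PRINTED CJS FACTS — Thm. 3.14 (`CossartJannsenSaito2020_thm_3_14`), its
near-fibre form (`Thm314_nearFibre_subsingleton`, F-61) and its point-centre locus form (`Thm314_point_locus`) — AND THE TWO LOCAL KERNELS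
(K-ctr-cv) (curve-centre dominant members) and (c-geo) (lineage in the centre).** `ProjDir_projLine` is fed by `ProjDir_projLine_holds`.
[cite: CossartJannsenSaito2020, Thm. 3.14, Def. 6.38 (ii), Thm. 6.35, Rem. 6.29 (1)] -/
theorem wlow3CharStrataM_of_thm_3_14_pointLocus_curve_centreIO {p : ℕ} (h314 : CossartJannsenSaito2020_thm_3_14.{0})
    (hFf : Thm314_nearFibre_subsingleton.{0}) (h314pt : Thm314_point_locus.{0})
    (hcv : StrataCurveCentreDominantClean.{0} p 3 (QNe (Helpers.QCharRegime p)) fun s => s.geomDirDim ≤ 2)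
    (hgeo : StrataLineageInCentreIO.{0} p 3 (QNe (Helpers.QCharRegime p)) fun s => s.geomDirDim ≤ 2) :
    Wlow3CharStrataM p :=
  wlow3CharStrataM_of_printed_curve_centreIO h314 hFf ProjDir_projLine_holds h314pt hcv hgeo

/-- **NET OF RECORD, regime-free β-twin: `WlowStrataM p` (stub-3's socket `hS`) FROM THE THREE (F1♯) BINDERS `Theorem314_geomDir`,
`Theorem314_nearFibre_geomDir`, `Thm314_point_locus_geomDir` AND THE TWO LOCAL KERNELS (K-ctr-cv)⊤, (c-geo)⊤.**
[cite: CossartJannsenSaito2020, Thm. 3.14, Def. 6.38 (ii), Thm. 6.35, Rem. 6.29 (1)] -/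
theorem wlowStrataM_of_geomDir_pointLocus_curve_centreIO {p : ℕ} (hF : Theorem314_geomDir.{0})
    (hFf : Theorem314_nearFibre_geomDir.{0}) (h314pt : Thm314_point_locus_geomDir.{0})
    (hcv : StrataCurveCentreDominantClean.{0} p 3 (QNe fun _ _ _ _ => True) fun s => s.geomDirDim ≤ 2)
    (hgeo : StrataLineageInCentreIO.{0} p 3 (QNe fun _ _ _ _ => True) fun s => s.geomDirDim ≤ 2) : WlowStrataM p :=
  wlowStrataM_of_geomDir_projLine_curve_centreIO hF hFf ProjDir_projLine_holds h314pt hcv hgeo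

/-- The `Q`-generic strata row with `ProjDir_projLine` discharged. [cite: CossartJannsenSaito2020, Thm. 3.14, Def. 6.38 (ii)] -/
theorem maxOriginNoMovingNearChainAtQ_notIso_of_geomDir_pointLocus_curve_centreIO {p : ℕ}
    {Q : ℕ → (ℕ → ℕ) → ∀ X : Scheme.{u}, X → Prop} (hF : Theorem314_geomDir.{u}) (hFf : Theorem314_nearFibre_geomDir.{u})
    (h314pt : Thm314_point_locus_geomDir.{u})
    (hcv : StrataCurveCentreDominantClean.{u} p 3 (QNe Q) fun s => s.geomDirDim ≤ 2)
    (hgeo : StrataLineageInCentreIO p 3 (QNe Q) fun s => s.geomDirDim ≤ 2) :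
    MaxOriginNoMovingNearChainAtQ p 3 Q fun s => s.geomDirDim ≤ 2 ∧ ¬ Iso 3 s :=
  maxOriginNoMovingNearChainAtQ_notIso_of_geomDir_projLine_curve_centreIO hF hFf ProjDir_projLine_holds h314pt hcv hgeo

end Summit.ResolutionOfSingularities.ResolutionOfSingularities.Theorems.SigmaMaxModificationsCorridor3.Moving

end
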